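/-
Origin: expansion seat `planner-pub-hodgecm-pv14-g6-0`, handover import Pv14g6.SchwartzExpFlow -> import HodgeCM.Automorphic.SchwartzExpFlow (HodgeCM.Automorphic.SchwartzWeilLevi landed r30, untouched) ; after t31 row 13 (SchwartzExpFlow) (`HOME/pub-hodgecm-pv14-g6/lean/Pv14g6/SchwartzWeilLeviSmooth.lean`, md5 94ad0332, 123 lines);
landed by the gen-8 packager in gate run 31 as `HodgeCM/Automorphic/SchwartzWeilLeviSmooth.lean` (import ^import Pv14g6\.SchwartzExpFlow[ \t]*$→import HodgeCM.Automorphic.SchwartzExpFlow ×1).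
-/
/-
Copyright: HodgeCM public adjudication package, seat pub-hodgecm-pv14-g6 (DAG-NODE PROVER #14, gen 6).
File #29 of this seat.  Kernel-checked, no new axioms.  Imports file #28 of this seat, the landed
`HodgeCM.Automorphic.SchwartzWeilLevi` (this seat, gate run 30) and Mathlib only.
-/
import Summits.HodgeConjecture.HodgeCM.Automorphic.SchwartzExpFlow
import Summits.HodgeConjecture.HodgeCM.Automorphic.SchwartzWeilLevi

/-!
# Smooth vectors of the Levi factor: `s ↦ L_{exp(sA)} Φ` is differentiable in `𝓢(V, ℂ)`

`HodgeCM.Automorphic.SchwartzWeilLevi` (gate run 30) realises the Levi factor `GL(V)` of the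
Schrödinger-model Weil representation by the dilation operators `leviCLM V g Φ = Φ ∘ g⁻¹`.  File #28
makes every operator exponential `exp(sA)` a Schwartz-differentiable flow.  Here the two are joined:
along every one-parameter subgroup `s ↦ exp(sA)` of `GL(V)`,

* `leviCLM_expFlow : leviCLM V (expFlow A s) = (Φ ↦ Φ ∘ exp(s(-A)))` (the inverse flips the sign of
  the generator: `symm_expFlow : (expFlow A s).symm = expFlow (-A) s`, `flowGen_neg_apply`);
* **`tendsto_leviCLM_expFlow_sub_div_ofReal`** —
  `((s : ℂ))⁻¹ • (L_{exp(sA)} Φ - Φ) → flowGen (-A) Φ = -(x ↦ DΦ(x)[Ax])` in the Schwartz topology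
  (`s → 0`, `s ≠ 0`), i.e. every Schwartz function is a differentiable vector of the Levi factor
  along every one-parameter subgroup, with the Euler-type generator; the base-point version
  `tendsto_leviCLM_expFlow_sub_div_ofReal_at`, the real-scalar version, and `C^∞` scalar coefficients
  `contDiff_apply_leviCLM_expFlow`.

Only published mathematics is used (Mathlib); `leviCLM` is this package's kernel definition
(`Φ ∘ g⁻¹`, no normalising character — the projective Levi factor); nothing refers to the objects
under adjudication.
-/

noncomputable section

open Filter Topology
open scoped SchwartzMap ContDiff

namespace HodgeCM
namespace SchwartzWeil

section InverseFlow

variable {E : Type*} [NormedAddCommGroup E] [NormedSpace ℝ E] (A : E →L[ℝ] E)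

/-- The generator flips sign: `(flowGen (-A) Φ) x = -DΦ(x)[Ax] = -(flowGen A Φ) x`. -/
theorem flowGen_neg_apply {F : Type*} [NormedAddCommGroup F] [NormedSpace ℝ F] (Φ : 𝓢(E, F))
    (x : E) : flowGen (-A) Φ x = -(fderiv ℝ (Φ : E → F) x (A x)) := by
  rw [flowGen_apply, ← map_neg]
  rfl

/-- (Ported verbatim from the HodgeCMPerL package; no docstring in the source.) -/
theorem flowGen_neg_apply' {F : Type*} [NormedAddCommGroup F] [NormedSpace ℝ F] (Φ : 𝓢(E, F))
    (x : E) : flowGen (-A) Φ x = -(flowGen A Φ x) := by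
  rw [flowGen_neg_apply, flowGen_apply]

variable [CompleteSpace E]

/-- `exp(sA)⁻¹ = exp(s(-A))` as continuous linear equivalences. -/
theorem symm_expFlow (s : ℝ) : (expFlow A s).symm = expFlow (-A) s := by
  refine ContinuousLinearEquiv.ext (funext fun x => ?_)
  show NormedSpace.exp ((-s) • A) x = NormedSpace.exp (s • (-A)) x
  rw [neg_smul, smul_neg]

end InverseFlow

section Levi

variable (V : Type) [NormedAddCommGroup V] [InnerProductSpace ℝ V] [CompleteSpace V]
variable (A : V →L[ℝ] V)

/-- Along a one-parameter subgroup the Levi operator is composition with the inverse flow: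
`L_{exp(sA)} = (Φ ↦ Φ ∘ exp(s(-A)))`. -/
theorem leviCLM_expFlow (s : ℝ) :
    leviCLM V (expFlow A s) = SchwartzMap.compCLMOfContinuousLinearEquiv ℂ (expFlow (-A) s) := by
  rw [leviCLM, symm_expFlow]

/-- (Ported verbatim from the HodgeCMPerL package; no docstring in the source.) -/
theorem leviCLM_expFlow_apply (s : ℝ) (Φ : 𝓢(V, ℂ)) :
    leviCLM V (expFlow A s) Φ = SchwartzMap.compCLMOfContinuousLinearEquiv ℂ (expFlow (-A) s) Φ := by
  rw [leviCLM_expFlow]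

/-- **Every Schwartz function is a differentiable vector of the Levi factor along `exp(sA)`**
(complex scalars, the literal smooth-vector-clause shape):
`((s : ℂ))⁻¹ • (L_{exp(sA)} Φ - Φ) → flowGen (-A) Φ` in `𝓢(V, ℂ)`, `s → 0`, `s ≠ 0`. -/
theorem tendsto_leviCLM_expFlow_sub_div_ofReal (Φ : 𝓢(V, ℂ)) :
    Tendsto (fun s : ℝ => ((s : ℂ))⁻¹ • (leviCLM V (expFlow A s) Φ - Φ)) (𝓝[≠] 0)
      (𝓝 (flowGen (-A) Φ)) := by
  simp only [leviCLM_expFlow_apply]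
  exact tendsto_compCLM_expFlow_sub_div_ofReal (-A) Φ

/-- The same at every base point `s₀` of the subgroup. -/
theorem tendsto_leviCLM_expFlow_sub_div_ofReal_at (Φ : 𝓢(V, ℂ)) (s₀ : ℝ) :
    Tendsto (fun s : ℝ => ((s : ℂ))⁻¹
        • (leviCLM V (expFlow A (s₀ + s)) Φ - leviCLM V (expFlow A s₀) Φ)) (𝓝[≠] 0)
      (𝓝 (flowGen (-A) (leviCLM V (expFlow A s₀) Φ))) := by
  simp only [leviCLM_expFlow_apply]
  exact tendsto_compCLM_expFlow_sub_div_ofReal_at (-A) Φ s₀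

/-- Real-scalar form at every base point. -/
theorem tendsto_leviCLM_expFlow_sub_div_at (Φ : 𝓢(V, ℂ)) (s₀ : ℝ) :
    Tendsto (fun s : ℝ => s⁻¹
        • (leviCLM V (expFlow A (s₀ + s)) Φ - leviCLM V (expFlow A s₀) Φ)) (𝓝[≠] 0)
      (𝓝 (flowGen (-A) (leviCLM V (expFlow A s₀) Φ))) := by
  simp only [leviCLM_expFlow_apply]
  exact tendsto_compCLM_expFlow_sub_div_at ℂ (-A) Φ s₀

/-- Scalar coefficients `s ↦ T (L_{exp(sA)} Φ)` are `C^∞` on `ℝ`, for every real-linear continuous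
`T` (in particular every tempered distribution composed with `re`/`im`, or `Φ ↦ Φ x`). -/
theorem contDiff_apply_leviCLM_expFlow {G : Type*} [NormedAddCommGroup G] [NormedSpace ℝ G]
    (T : 𝓢(V, ℂ) →L[ℝ] G) (Φ : 𝓢(V, ℂ)) :
    ContDiff ℝ ∞ (fun s : ℝ => T (leviCLM V (expFlow A s) Φ)) := by
  simp only [leviCLM_expFlow_apply]
  exact contDiff_apply_compCLM_expFlow ℂ (-A) T Φ

/-- With derivative `T (flowGen (-A) (L_{exp(s₀A)} Φ))` at every `s₀`. -/
theorem hasDerivAt_apply_leviCLM_expFlow {G : Type*} [NormedAddCommGroup G] [NormedSpace ℝ G]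
    (T : 𝓢(V, ℂ) →L[ℝ] G) (Φ : 𝓢(V, ℂ)) (s₀ : ℝ) :
    HasDerivAt (fun s : ℝ => T (leviCLM V (expFlow A s) Φ))
      (T (flowGen (-A) (leviCLM V (expFlow A s₀) Φ))) s₀ := by
  simp only [leviCLM_expFlow_apply]
  exact hasDerivAt_apply_compCLM_expFlow ℂ (-A) T Φ s₀


end Levi

end SchwartzWeil
end HodgeCM
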